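import Literature.NumberTheory.Sieve.FriedlanderIwaniecPrimesSeparationLemma
import HarnessLib

/-!
# Friedlander–Iwaniec, *The polynomial `X² + Y⁴` captures its primes*, §§20–21: separation of variables in a threshold condition inside a bilinear form

Family `parity` (rung F-SPIN; the tool for Proposition 21.4 / 23.1). Source: J. Friedlander,
H. Iwaniec, Ann. of Math. (2) 148 (1998), 945–1040 [FriedlanderIwaniecAnnals1998]
(= arXiv:math/9811185), §20, (20.15)–(20.19) and §21, proof of Proposition 21.4: the sign `ε(w, z)`
of Lemma 20.1 is expressed through `sign(Re wz)` ((20.15)), and "the formula (20.15) reduces the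
problem of the separation of variables in `ε(w, z)` to that in `sign(Re wz)`, and the latter requires
an application of harmonic analysis. One can proceed in a number of ways. We shall use the characters
`e^{ik arg z}` … (20.18) `Σ_k |t̂(k)| ≪ log 2R`" — i.e. a threshold condition coupling the two
variables of a bilinear form is removed at the cost of a factor `≪ log R` by writing its indicator
as an absolutely convergent superposition of products of unimodular functions of each variable.

This file proves that principle in the form used downstream, by one of the other "number of ways":
instead of the Fourier SERIES of a smoothed sign function in `arg(wz) = arg w + arg z` we use the
Fourier TRANSFORM of the trapezoid of Lemma 26.1 (the tree's `trapz`, `integral_cexp_mul_fourier_trapzC`,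
`integral_norm_fourier_trapzC_le`, Duke–Friedlander–Iwaniec) in a difference `A(z) - B(w)`
(for `sign(Re wz) = sign(ur - vs)` one takes `A(z) = s/r`, `B(w) = u/v` on the sign classes of
`v, r`). Everything is PROVED; no named facts, no new definitions besides the bound predicate.

* `BilinBoundedBy K W Z X` — "every bilinear form `Σ_{w∈W} Σ_{z∈Z} a(w) b(z) K(w,z)` with
  `|a|, |b| ≤ 1` has norm `≤ X`" (the shape of Proposition 21.3 / (21.13)).
* `indicator_lt_eq_integral` — for `1/R ≤ |A z - B w| ≤ R`:
  `[B w < A z] = ∫ e^{2πiξ(R(Az - Bw) - 1)} 𝓕H(ξ) dξ` with `H = trapz R² 1`.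
* `BilinBoundedBy.threshold` — **the separation bound**: if `BilinBoundedBy K W Z X` and
  `1/R ≤ |A z - B w| ≤ R` on `W × Z` (`R ≥ 1`), then
  `BilinBoundedBy (fun w z => [B w < A z] · K w z) W Z (3(1 + log R) · X)`.
  Being of the same shape as its hypothesis, it can be iterated (two threshold conditions cost
  `(3(1 + log R))²`).

## References

* J. Friedlander, H. Iwaniec, Ann. of Math. (2) 148 (1998), 945–1040, §20 (20.15)–(20.19), §21
  (proof of Proposition 21.4), §26 Lemma 26.1. [FriedlanderIwaniecAnnals1998]
* W. Duke, J. Friedlander, H. Iwaniec, Invent. Math. 128 (1997), 23–43, Lemma 9.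

## Tree / Mathlib

Tree: `trapz`, `trapzC`, `trapz_of_mem_mid`, `trapz_of_le_neg_two`, `integral_cexp_mul_fourier_trapzC`,
`integral_norm_fourier_trapzC_le`, `integral_fourierMajorant_le`, `integrable_fourier_trapzC`,
`continuous_fourier_trapzC` (`FriedlanderIwaniecPrimesSeparationLemma`). Mathlib:
`MeasureTheory.integral_finsetSum`, `Integrable.bdd_mul`, `norm_integral_le_of_norm_le`,
`Real.log_two_lt_d9`, `Real.pi_gt_three`.
-/

noncomputable section

open Real Complex MeasureTheory Set Finset
open scoped FourierTransform

namespace Literature.NumberTheory.Sieve.FriedlanderIwaniecPrimes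

/-! ### Bilinear forms bounded for all bounded coefficients -/

/-- "Every bilinear form in the kernel `K` over `W × Z` with coefficients bounded by `1` is `≤ X` in
norm" — the shape of (21.10)/(21.13). [cite: FriedlanderIwaniecAnnals1998, (21.13)] -/
def BilinBoundedBy {ι κ : Type*} (K : ι → κ → ℂ) (W : Finset ι) (Z : Finset κ) (X : ℝ) : Prop :=
  ∀ a : ι → ℂ, ∀ b : κ → ℂ, (∀ w, ‖a w‖ ≤ 1) → (∀ z, ‖b z‖ ≤ 1) →
    ‖∑ w ∈ W, ∑ z ∈ Z, a w * b z * K w z‖ ≤ X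

variable {ι κ : Type*}

/-- Unfolding. [cite: FriedlanderIwaniecAnnals1998, (21.13)] -/
theorem bilinBoundedBy_iff (K : ι → κ → ℂ) (W : Finset ι) (Z : Finset κ) (X : ℝ) :
    BilinBoundedBy K W Z X ↔ ∀ a : ι → ℂ, ∀ b : κ → ℂ, (∀ w, ‖a w‖ ≤ 1) → (∀ z, ‖b z‖ ≤ 1) →
      ‖∑ w ∈ W, ∑ z ∈ Z, a w * b z * K w z‖ ≤ X := Iff.rfl

/-- The bound (21.13)-type predicate is nonnegative (take `a = b = 0`). [cite: FriedlanderIwaniecAnnals1998, (21.13)] -/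
theorem BilinBoundedBy.nonneg {K : ι → κ → ℂ} {W : Finset ι} {Z : Finset κ} {X : ℝ}
    (h : BilinBoundedBy K W Z X) : 0 ≤ X := by
  have := h (fun _ => 0) (fun _ => 0) (fun _ => by simp) (fun _ => by simp)
  simpa using this

/-- Monotonicity of the (21.13)-type predicate in the bound. [cite: FriedlanderIwaniecAnnals1998, (21.13)] -/
theorem BilinBoundedBy.mono {K : ι → κ → ℂ} {W : Finset ι} {Z : Finset κ} {X X' : ℝ}
    (h : BilinBoundedBy K W Z X) (hX : X ≤ X') : BilinBoundedBy K W Z X' :=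
  fun a b ha hb => (h a b ha hb).trans hX

/-- Twisting the kernel by unimodular (or merely bounded) factors of each variable separately keeps
the bound: "these problems are essentially equivalent as long as the coefficients `α_w, β_z` are
arbitrary but bounded". [cite: FriedlanderIwaniecAnnals1998, §21, remark before (21.11)] -/
theorem BilinBoundedBy.twist {K : ι → κ → ℂ} {W : Finset ι} {Z : Finset κ} {X : ℝ}
    (h : BilinBoundedBy K W Z X) (f : ι → ℂ) (g : κ → ℂ) (hf : ∀ w, ‖f w‖ ≤ 1) (hg : ∀ z, ‖g z‖ ≤ 1) :
    BilinBoundedBy (fun w z => f w * g z * K w z) W Z X := by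
  intro a b ha hb
  have := h (fun w => a w * f w) (fun z => b z * g z)
    (fun w => by rw [norm_mul]; exact mul_le_one₀ (ha w) (norm_nonneg _) (hf w))
    (fun z => by rw [norm_mul]; exact mul_le_one₀ (hb z) (norm_nonneg _) (hg z))
  refine le_of_eq_of_le ?_ this
  congr 1
  refine sum_congr rfl fun w _ => sum_congr rfl fun z _ => ?_
  ring

/-! ### The threshold indicator as a Fourier integral of the trapezoid -/

/-- The indicator `[B < A]` written through the trapezoid `H = trapz R² 1` of Lemma 26.1: for
`1/R ≤ |A - B| ≤ R`, `[B < A] = H(R(A - B) - 1)`. [cite: FriedlanderIwaniecAnnals1998, Lemma 26.1] -/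
theorem indicator_lt_eq_trapz {R A B : ℝ} (hR : 1 ≤ R) (hgap : 1 / R ≤ |A - B|) (hsize : |A - B| ≤ R) :
    (if B < A then (1 : ℝ) else 0) = trapz (R ^ 2) 1 (R * (A - B) - 1) := by
  have hR0 : 0 < R := by linarith
  split_ifs with h
  · -- `R(A - B) ≥ 1`
    have hAB : 0 < A - B := by linarith
    rw [abs_of_pos hAB] at hgap hsize
    have h1 : 1 ≤ R * (A - B) := by
      have := mul_le_mul_of_nonneg_left hgap hR0.le
      rwa [mul_one_div_cancel hR0.ne'] at this
    have h2 : R * (A - B) ≤ R ^ 2 := by nlinarith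
    exact (trapz_of_mem_mid one_pos ⟨by linarith, by linarith⟩).symm
  · -- `R(A - B) ≤ -1`
    push Not at h
    have hAB : A - B ≤ 0 := by linarith
    have hne : A - B ≠ 0 := by
      intro h0; rw [h0, abs_zero] at hgap
      have : 0 < 1 / R := by positivity
      linarith
    have hlt : A - B < 0 := lt_of_le_of_ne hAB hne
    rw [abs_of_neg hlt] at hgap
    have h1 : R * (A - B) ≤ -1 := by
      have := mul_le_mul_of_nonneg_left hgap hR0.le
      rw [mul_one_div_cancel hR0.ne'] at this
      linarith
    exact (trapz_of_le_neg_two (by linarith)).symm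

/-- **The indicator as an absolutely convergent superposition of separable phases**:
`[B < A] = ∫ e^{2πiξ(R(A-B)-1)} 𝓕H(ξ) dξ`, `H = trapz R² 1`, whenever `1/R ≤ |A - B| ≤ R`.
[cite: FriedlanderIwaniecAnnals1998, (20.19) / Lemma 26.1] -/
theorem indicator_lt_eq_integral {R A B : ℝ} (hR : 1 ≤ R) (hgap : 1 / R ≤ |A - B|)
    (hsize : |A - B| ≤ R) :
    (if B < A then (1 : ℂ) else 0) =
      ∫ ξ : ℝ, cexp (2 * π * I * (ξ : ℂ) * ((R * (A - B) - 1 : ℝ) : ℂ)) * 𝓕 (trapzC (R ^ 2) 1) ξ := by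
  rw [integral_cexp_mul_fourier_trapzC one_pos (by positivity)]
  show _ = ((trapz (R ^ 2) 1 (R * (A - B) - 1) : ℝ) : ℂ)
  rw [← indicator_lt_eq_trapz hR hgap hsize]
  split_ifs <;> simp

/-! ### The `L¹` norm of `𝓕H` -/

/-- `∫ ‖𝓕 H‖ ≤ 3 (1 + log R)` for `H = trapz R² 1`, `R ≥ 1`. [cite: FriedlanderIwaniecAnnals1998, (20.18)] -/
theorem integral_norm_fourier_trapz_sq_le {R : ℝ} (hR : 1 ≤ R) :
    ∫ ξ : ℝ, ‖𝓕 (trapzC (R ^ 2) 1) ξ‖ ≤ 3 * (1 + Real.log R) := by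
  have hR0 : 0 < R := by linarith
  have h1 := integral_norm_fourier_trapzC_le (L := R ^ 2) (δ := 1) one_pos (by positivity)
  have h2 := integral_fourierMajorant_le (L := R ^ 2) (δ := 1) one_pos (by norm_num) (by positivity)
  have hπ := Real.pi_gt_three
  have hlog2 := Real.log_two_lt_d9
  have hlogR : 0 ≤ Real.log R := Real.log_nonneg hR
  -- `log(1 + R² + 1/2) ≤ log 4 + 2 log R`
  have hT : Real.log (1 + R ^ 2 + 1 / 2) ≤ 2 * Real.log 2 + 2 * Real.log R := by
    have h4 : 1 + R ^ 2 + 1 / 2 ≤ 4 * R ^ 2 := by nlinarith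
    calc Real.log (1 + R ^ 2 + 1 / 2) ≤ Real.log (4 * R ^ 2) := Real.log_le_log (by positivity) h4
      _ = Real.log (2 ^ 2) + Real.log (R ^ 2) := by rw [Real.log_mul (by norm_num) (by positivity)]; norm_num
      _ = 2 * Real.log 2 + 2 * Real.log R := by rw [Real.log_pow, Real.log_pow]; push_cast; ring
  have hlog2' : Real.log (2 / 1) = Real.log 2 := by norm_num
  rw [hlog2'] at h2
  have hA : 3 / (2 * π) ≤ 1 / 2 := by rw [div_le_iff₀ (by positivity)]; linarith
  have hB : Real.log (1 + R ^ 2 + 1 / 2) / π ≤ (2 * Real.log 2 + 2 * Real.log R) / 3 :=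
    div_le_div₀ (by positivity) hT (by norm_num) hπ.le
  have hC : Real.log 2 / (2 * π) ≤ 0.7 / 6 :=
    div_le_div₀ (by norm_num) (hlog2.le.trans (by norm_num)) (by norm_num) (by linarith)
  calc ∫ ξ : ℝ, ‖𝓕 (trapzC (R ^ 2) 1) ξ‖
      ≤ 2 * ∫ w in Ioi (0 : ℝ), fourierMajorant (1 + R ^ 2 + 1 / 2) 1 w := h1
    _ ≤ 2 * (3 / (2 * π) + Real.log (1 + R ^ 2 + 1 / 2) / π + Real.log 2 / (2 * π)) := by linarith
    _ ≤ 2 * (1 / 2 + (2 * Real.log 2 + 2 * Real.log R) / 3 + 0.7 / 6) := by linarith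
    _ ≤ 3 * (1 + Real.log R) := by nlinarith

/-! ### The separation bound -/

/-- **Separation of a threshold condition in a bilinear form** (the principle of (20.15)–(20.19) in
the proof of Proposition 21.4, implemented with the Fourier transform of the trapezoid of Lemma 26.1):
if every bilinear form `Σ_w Σ_z a(w) b(z) K(w,z)` with `|a|, |b| ≤ 1` is `≤ X`, and the real
quantities `A(z)`, `B(w)` satisfy `1/R ≤ |A(z) - B(w)| ≤ R` on `W × Z` (`R ≥ 1`), then every bilinear
form `Σ_w Σ_z a(w) b(z) [B(w) < A(z)] K(w,z)` with `|a|, |b| ≤ 1` is `≤ 3(1 + log R) X`.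
[cite: FriedlanderIwaniecAnnals1998, Proposition 21.4 (proof)] -/
theorem BilinBoundedBy.threshold {K : ι → κ → ℂ} {W : Finset ι} {Z : Finset κ} {X : ℝ}
    (h : BilinBoundedBy K W Z X) {A : κ → ℝ} {B : ι → ℝ} {R : ℝ} (hR : 1 ≤ R)
    (hgap : ∀ w ∈ W, ∀ z ∈ Z, 1 / R ≤ |A z - B w|) (hsize : ∀ w ∈ W, ∀ z ∈ Z, |A z - B w| ≤ R) :
    BilinBoundedBy (fun w z => (if B w < A z then (1 : ℂ) else 0) * K w z) W Z
      (3 * (1 + Real.log R) * X) := by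
  intro a b ha hb
  have hX0 : 0 ≤ X := h.nonneg
  set H : ℝ → ℂ := 𝓕 (trapzC (R ^ 2) 1) with hH
  have hHint : Integrable H := integrable_fourier_trapzC one_pos (by positivity)
  have hHcont : Continuous H := continuous_fourier_trapzC one_pos _
  -- the twisted coefficients
  set aξ : ℝ → ι → ℂ := fun ξ w => a w * cexp (2 * π * I * (ξ : ℂ) * ((-(R * B w) - 1 : ℝ) : ℂ))
    with haξ
  set bξ : ℝ → κ → ℂ := fun ξ z => b z * cexp (2 * π * I * (ξ : ℂ) * ((R * A z : ℝ) : ℂ)) with hbξ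
  have hphase : ∀ t ξ : ℝ, ‖cexp (2 * π * I * (ξ : ℂ) * (t : ℂ))‖ = 1 := by
    intro t ξ
    rw [show (2 * π * I * (ξ : ℂ) * (t : ℂ)) = ((2 * π * ξ * t : ℝ) : ℂ) * I by push_cast; ring,
      Complex.norm_exp_ofReal_mul_I]
  have haξ1 : ∀ ξ w, ‖aξ ξ w‖ ≤ 1 := fun ξ w => by
    rw [haξ]; simp only; rw [norm_mul, hphase, mul_one]; exact ha w
  have hbξ1 : ∀ ξ z, ‖bξ ξ z‖ ≤ 1 := fun ξ z => by
    rw [hbξ]; simp only; rw [norm_mul, hphase, mul_one]; exact hb z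
  -- the bilinear form at frequency `ξ`
  set S : ℝ → ℂ := fun ξ => ∑ w ∈ W, ∑ z ∈ Z, aξ ξ w * bξ ξ z * K w z with hS
  have hSbound : ∀ ξ, ‖S ξ‖ ≤ X := fun ξ => h _ _ (haξ1 ξ) (hbξ1 ξ)
  have hScont : Continuous S := by
    rw [hS]
    refine continuous_finsetSum _ fun w _ => continuous_finsetSum _ fun z _ => ?_
    rw [haξ, hbξ]
    fun_prop
  -- each summand as an integral
  have hterm : ∀ w ∈ W, ∀ z ∈ Z,
      a w * b z * ((if B w < A z then (1 : ℂ) else 0) * K w z) =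
        ∫ ξ : ℝ, aξ ξ w * bξ ξ z * K w z * H ξ := by
    intro w hw z hz
    rw [indicator_lt_eq_integral hR (hgap w hw z hz) (hsize w hw z hz), ← integral_mul_const,
      ← integral_const_mul]
    refine integral_congr_ae (Filter.Eventually.of_forall fun ξ => ?_)
    rw [haξ, hbξ, hH]
    simp only
    have : cexp (2 * π * I * (ξ : ℂ) * ((R * (A z - B w) - 1 : ℝ) : ℂ)) =
        cexp (2 * π * I * (ξ : ℂ) * ((-(R * B w) - 1 : ℝ) : ℂ)) *
          cexp (2 * π * I * (ξ : ℂ) * ((R * A z : ℝ) : ℂ)) := by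
      rw [← Complex.exp_add]; congr 1; push_cast; ring
    rw [this]; ring
  have hint : ∀ w ∈ W, ∀ z ∈ Z, Integrable fun ξ : ℝ => aξ ξ w * bξ ξ z * K w z * H ξ := by
    intro w _ z _
    refine hHint.bdd_mul (c := ‖K w z‖) ?_ (Filter.Eventually.of_forall fun ξ => ?_)
    · rw [haξ, hbξ]
      exact Continuous.aestronglyMeasurable (by fun_prop)
    · rw [norm_mul, norm_mul]
      calc ‖aξ ξ w‖ * ‖bξ ξ z‖ * ‖K w z‖ ≤ 1 * 1 * ‖K w z‖ :=
            mul_le_mul_of_nonneg_right (mul_le_mul (haξ1 ξ w) (hbξ1 ξ z) (norm_nonneg _) zero_le_one)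
              (norm_nonneg _)
        _ = ‖K w z‖ := by ring
  -- exchange sum and integral
  have hsum : ∑ w ∈ W, ∑ z ∈ Z, a w * b z * ((if B w < A z then (1 : ℂ) else 0) * K w z) =
      ∫ ξ : ℝ, S ξ * H ξ := by
    calc ∑ w ∈ W, ∑ z ∈ Z, a w * b z * ((if B w < A z then (1 : ℂ) else 0) * K w z)
        = ∑ w ∈ W, ∑ z ∈ Z, ∫ ξ : ℝ, aξ ξ w * bξ ξ z * K w z * H ξ :=
          sum_congr rfl fun w hw => sum_congr rfl fun z hz => hterm w hw z hz
      _ = ∑ w ∈ W, ∫ ξ : ℝ, ∑ z ∈ Z, aξ ξ w * bξ ξ z * K w z * H ξ :=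
          sum_congr rfl fun w hw => (integral_finsetSum Z fun z hz => hint w hw z hz).symm
      _ = ∫ ξ : ℝ, ∑ w ∈ W, ∑ z ∈ Z, aξ ξ w * bξ ξ z * K w z * H ξ :=
          (integral_finsetSum W fun w hw => integrable_finsetSum Z fun z hz => hint w hw z hz).symm
      _ = ∫ ξ : ℝ, S ξ * H ξ := by
          refine integral_congr_ae (Filter.Eventually.of_forall fun ξ => ?_)
          simp only [hS, sum_mul]
  rw [hsum]
  -- bound the integral
  have hle : ∀ ξ, ‖S ξ * H ξ‖ ≤ X * ‖H ξ‖ := fun ξ => by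
    rw [norm_mul]; exact mul_le_mul_of_nonneg_right (hSbound ξ) (norm_nonneg _)
  calc ‖∫ ξ : ℝ, S ξ * H ξ‖ ≤ ∫ ξ : ℝ, X * ‖H ξ‖ :=
        norm_integral_le_of_norm_le (hHint.norm.const_mul X) (Filter.Eventually.of_forall hle)
    _ = X * ∫ ξ : ℝ, ‖H ξ‖ := integral_const_mul _ _
    _ ≤ X * (3 * (1 + Real.log R)) :=
        mul_le_mul_of_nonneg_left (integral_norm_fourier_trapz_sq_le hR) hX0
    _ = 3 * (1 + Real.log R) * X := by ring

end Literature.NumberTheory.Sieve.FriedlanderIwaniecPrimes
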